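/-
Copyright: pub-rosobs cell (Resolution Observatory), carver gen 41.  Companion file; statements OURS, in
the cell's polynomial weighted-centre model `W(f)`.  Instrument — NOT a resolution theorem.
-/
import Literature.AlgebraicGeometry.Resolution.WeightedCentreUmbrellaCubeMax
import HarnessLib

/-!
# `max W(v² + u w² + w z^q) = (2, 3, 3, 3q/2)` — the umbrella with a tail on the handle

Cell model (see `WeightedCentreInvariantSet`): `W(f) = admissibleInvariants f` is the set of invariants
`(1/γ₁ ≤ 1/γ₂ ≤ …)` of centres `(Ψ, γ)` — `Ψ` ANY `k`-algebra automorphism of `k[X_1, …, X_N]` fixing the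
origin, `γ` non-negative rational weights — that are admissible for `f` (every monomial of `Ψ⁻¹ f` has
`γ`-value `≥ 1`).  This file treats the last normal form of the cell's characteristic-`p` stall census that
was not yet typed, the germ

  `f = X_i² + X_l X_j² + X_j X_e^q`   (`i, j, l, e` distinct, any number of spectator variables),

i.e. `v² + u w² + w z^q`: the Whitney umbrella `v² + u w²` with the tail `w z^q` attached to the handle
coordinate `w` (census row `v² + u w² + w z⁴` over `𝔽₂`, value `(2, 3, 3, 6)`).

**Main results.**
* `umbrellaTail_inv_mem`: `(2, 3, 3, 3q/2) ∈ W(f)` — the coordinate centre with weights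
  `(1/2, 1/3, 1/3, 2/(3q))` on `(X_i, X_j, X_l, X_e)` (`q ≥ 2`); note the NON-INTEGRAL last exponent;
* `not_lt_233_of_mem_admissibleInvariants` (general first face: `ord f = 2`, `in₂ f = X_i²`,
  `δ(f; X_i) = 3/2`, `τ(in_δ f) = 3` ⟹ nothing in `W(f)` is above `(2, 3, 3)`), and its instance
  `not_lt_of_mem_admissibleInvariants_umbrellaTail` (`q ≥ 3`, EVERY characteristic);
* `axis_endgame_tail`, `coeff_single_symm_eq_zero_of_vertex_tail`, `not_isCentreFor_umbrellaTail_vertex`: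
  for `q ≥ 3`, `c > 3q/2`, and (`2 = 0` in `k` or `q ≤ 4`) there is no centre with one weight `1/2`, two
  weights `1/3` and all other weights `≤ 1/c`;
* `not_isCentreFor_umbrellaTail_of_exps`, `triple_not_mem_admissibleInvariants_umbrellaTail`,
  `cons₄_not_mem_admissibleInvariants_umbrellaTail`: `(2, 3, 3) ∉ W(f)` and `(2, 3, 3, c, …) ∉ W(f)` for
  `c > 3q/2`;
* `isMaxInv_umbrellaTail`: **`max W(f) = (2, 3, 3, 3q/2)`** for `q ≥ 3` in characteristic `2`, and for
  `q ∈ {3, 4}` in EVERY characteristic (`isMaxInv_umbrellaTail_four`: the census row, `(2, 3, 3, 6)`;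
  `isMaxInv_umbrellaTail_three`: `(2, 3, 3, 9/2)`), against ALL polynomial coordinate changes and with any
  number of spectators.

**Proof.**  First face: Hironaka's vertex preparation with `y = X_i`, `ν = 2`, `δ = 3/2 ∉ ℕ`,
`in_δ f = X_i² + X_j² X_l` (the tail `X_j X_e^q`, `q ≥ 3`, is off the `δ`-face), `τ(in_δ f) = 3`
(`WeightedCentreVertexPreparation`), packaged once and for all in `not_lt_233_of_mem_admissibleInvariants`.
Second vertex: the single-axis method of `WeightedCentreUmbrellaPowSecondVertex` — apex
(`coeff_single_apex_of_initial`: the weight-`1/2` coordinate is `λ X_i + …`, `λ ≠ 0`), restriction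
`ρ = (X_{e₁} ↦ T, others ↦ 0) ∘ Ψ⁻¹` to a light axis, Taylor maps along `∂_i` and the two fields
`ξ_x = (∂_i v')∂_x − (∂_x v')∂_i` (`x = l, j`) tangent to `{v' = 0}`, transfer of admissibility
(`VanBelow₂.map_of_le_monomialValuation`), and a NEW endgame (`axis_endgame_tail`): with
`V, W, U, Z = ρ X_{i,j,l,e}`, `L = ρ ∂_i v'`, the slices give `ord W ≥ c/3` (so `W₁ = 0`), `V₁ = 0` from the
`T²`-coefficient of `V² + U W² + W Z^q`, `U₁ = 0` from `B² + L² U`, and — the new point — the `ε¹`-slice of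
`ξ_j`, `2 L U W + L Z^q − 2 V B`, vanishes below `2c/3 > q` and CONTAINS `L Z^q`, whose `T^q`-coefficient is
`L(0) Z₁^q`: in characteristic `2` the other two terms are absent, and for `q ≤ 4` they vanish at `T^q`
because `ord(U W) ≥ 2 + c/3 > q` and `ord(V B) ≥ c/2 + 1 > q`; either way `Z₁ = 0`.  Hence the rows
`i, j, l, e` of the Jacobian of `Ψ⁻¹` at `0` are supported on the three columns `a, b₁, b₂` — rank
contradiction (`false_of_jacobian_rows_supported`).  The invariant form peels the weights off `exps γ`
(`exists_update_of_exps_eq_cons`, `le_inv_of_exps_eq`).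

**Scope (not treated).**  For `q ≥ 5` in characteristic `≠ 2` the six slice conditions used here admit
consistent order profiles (e.g. `q = 5`: `ord B = 1`, `ord V = 4`, `ord U = 2`, `ord Z = 1`), so the
first-order axis data do not decide the vertex; the cell's engines computed the value `(2, 3, 3, 3q/2)`
only over `𝔽₂` (`q = 3, 4, 5, 6, 8, 12`).  Nothing is claimed here about `q ≥ 5`, `char k ≠ 2`.

References: [AbramovichTemkinWlodarczyk2024, Thm. 5.3.1 (2) (p. 1578) (the invariant is the maximum over
admissible centres), Lemma 5.2.10 (p. 1577), §5.1 (p. 1575), §3.4 (p. 1570)]; [Temkin2025, §1.2.2 (1)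
(p. 4) (umbrella-type germs `v² + u w² + …` in positive characteristic)]; [CossartJannsenSaito2020,
Def. 1.26, Def. 7.1 (p. 107), Def. 8.2 (p. 118), Thm. 8.16 (p. 121), Thm. 8.22 (p. 124)].  Statements ours
(the cell's model `W(f)`); value type: typed theorems in the polynomial weighted-centre model — NOT a
resolution theorem, NOT summit progress.
-/

open MvPolynomial

namespace Literature.AlgebraicGeometry.Resolution.WeightedBlowup

variable {k : Type*} [Field k] {N : ℕ}

/-! ## §1 The germ `X_i² + X_l X_j² + X_j X_e^q` and its Newton data -/

section Germ

variable (k) in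
/-- `X_i² + X_j² X_l + X_j X_e^q`: the Whitney umbrella `umbrella k i j l 2 2` plus the tail `X_j X_e^q` on
the handle coordinate (spectators allowed). (construction)
[cite: Temkin2025, §1.2.2 (1) (p. 4) (umbrella-type germs in positive characteristic)] -/
noncomputable def umbrellaTail (i j l e : Fin N) (q : ℕ) : MvPolynomial (Fin N) k :=
  umbrella k i j l 2 2 + X j * X e ^ q

/-- The exponent of the tail monomial `X_j X_e^q`. (construction, plumbing)
[cite: AbramovichTemkinWlodarczyk2024, §5.1 (p. 1575) (monomials and their weights)] -/
noncomputable def tailExp (j e : Fin N) (q : ℕ) : Fin N →₀ ℕ := Finsupp.single j 1 + Finsupp.single e q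

variable {i j l e : Fin N} {q : ℕ}

/-- `umbrellaTail = X_i² + X_l X_j² + X_j X_e^q` (the census normal form `v² + u w² + w z^q`). (plumbing)
[cite: Temkin2025, §1.2.2 (1) (p. 4)] -/
theorem umbrellaTail_eq : umbrellaTail k i j l e q = X i ^ 2 + X l * X j ^ 2 + X j * X e ^ q := by
  rw [umbrellaTail, umbrella]; ring

/-- The umbrella as a sum of two monomials (plumbing). [folklore] -/
private theorem umbrella_two_eq₉ (i j l : Fin N) :
    umbrella k i j l 2 2 = monomial (Finsupp.single i 2) 1 + monomial (umbExp j l 2) 1 := by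
  rw [umbrella, umbExp, X_pow_eq_monomial, X_pow_eq_monomial, ← pow_one (X l : MvPolynomial (Fin N) k),
    X_pow_eq_monomial, monomial_mul, mul_one]

/-- The tail as a monomial (plumbing). [folklore] -/
private theorem tail_eq_monomial :
    (X j * X e ^ q : MvPolynomial (Fin N) k) = monomial (tailExp j e q) 1 := by
  rw [tailExp, X_pow_eq_monomial, ← pow_one (X j : MvPolynomial (Fin N) k), X_pow_eq_monomial, monomial_mul,
    mul_one]

/-- The germ as a sum of three monomials (plumbing). [folklore] -/
private theorem umbrellaTail_eq_sum :
    umbrellaTail k i j l e q =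
      monomial (Finsupp.single i 2) 1 + monomial (umbExp j l 2) 1 + monomial (tailExp j e q) 1 := by
  rw [umbrellaTail, umbrella_two_eq₉, tail_eq_monomial]

/-- Exponent bookkeeping (plumbing). [folklore] -/
private theorem umbExp_two_apply₉ (x : Fin N) :
    umbExp j l 2 x = (if j = x then 2 else 0) + (if l = x then 1 else 0) := by
  rw [umbExp, Finsupp.add_apply, Finsupp.single_apply, Finsupp.single_apply]

/-- Exponent bookkeeping (plumbing). [folklore] -/
private theorem tailExp_apply (x : Fin N) :
    tailExp j e q x = (if j = x then 1 else 0) + (if e = x then q else 0) := by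
  rw [tailExp, Finsupp.add_apply, Finsupp.single_apply, Finsupp.single_apply]

/-- The three exponents are distinct (plumbing). [folklore] -/
private theorem single_two_ne_umbExp₉ (hil : i ≠ l) (hjl : j ≠ l) : Finsupp.single i 2 ≠ umbExp j l 2 := by
  intro h
  have := congrArg (fun d => d l) h
  simp only [Finsupp.single_apply, if_neg hil, umbExp_two_apply₉, if_neg hjl, if_true] at this
  omega

/-- The three exponents are distinct (plumbing). [folklore] -/
private theorem single_two_ne_tailExp (hij : i ≠ j) (hie : i ≠ e) : Finsupp.single i 2 ≠ tailExp j e q := by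
  intro h
  have := congrArg (fun d => d i) h
  simp only [Finsupp.single_apply, if_true, tailExp_apply, if_neg (Ne.symm hij), if_neg (Ne.symm hie)] at this
  omega

/-- The three exponents are distinct (plumbing). [folklore] -/
private theorem umbExp_ne_tailExp (hjl : j ≠ l) (hle : l ≠ e) : umbExp j l 2 ≠ tailExp j e q := by
  intro h
  have := congrArg (fun d => d l) h
  simp only [umbExp_two_apply₉, if_neg hjl, if_true, tailExp_apply, if_neg (Ne.symm hle)] at this
  omega

/-- Support of the germ (plumbing). [folklore] -/
private theorem mem_support_umbrellaTail {d : Fin N →₀ ℕ} (hd : d ∈ (umbrellaTail k i j l e q).support) :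
    d = Finsupp.single i 2 ∨ d = umbExp j l 2 ∨ d = tailExp j e q := by
  rw [umbrellaTail_eq_sum] at hd
  have h1 := support_add hd
  rw [Finset.mem_union] at h1
  rcases h1 with h1 | h1
  · have h2 := support_add h1
    rw [Finset.mem_union] at h2
    rcases h2 with h2 | h2
    · exact Or.inl (Finset.mem_singleton.1 (support_monomial_subset h2))
    · exact Or.inr (Or.inl (Finset.mem_singleton.1 (support_monomial_subset h2)))
  · exact Or.inr (Or.inr (Finset.mem_singleton.1 (support_monomial_subset h1)))

/-- Coefficients of the germ (plumbing). [folklore] -/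
private theorem coeff_single_two_umbrellaTail (hij : i ≠ j) (hil : i ≠ l) (hie : i ≠ e) (hjl : j ≠ l) :
    coeff (Finsupp.single i 2) (umbrellaTail k i j l e q) = 1 := by
  rw [umbrellaTail_eq_sum, coeff_add, coeff_add, coeff_monomial, coeff_monomial, coeff_monomial, if_pos rfl,
    if_neg (single_two_ne_umbExp₉ hil hjl).symm, if_neg (single_two_ne_tailExp (q := q) hij hie).symm,
    add_zero, add_zero]

/-- Coefficients of the germ (plumbing). [folklore] -/
private theorem coeff_umbExp_umbrellaTail (hil : i ≠ l) (hjl : j ≠ l) (hle : l ≠ e) :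
    coeff (umbExp j l 2) (umbrellaTail k i j l e q) = 1 := by
  rw [umbrellaTail_eq_sum, coeff_add, coeff_add, coeff_monomial, coeff_monomial, coeff_monomial,
    if_neg (single_two_ne_umbExp₉ hil hjl), if_pos rfl, if_neg (umbExp_ne_tailExp (q := q) hjl hle).symm,
    zero_add, add_zero]

/-- Coefficients of the germ (plumbing). [folklore] -/
private theorem coeff_tailExp_umbrellaTail (hij : i ≠ j) (hie : i ≠ e) (hjl : j ≠ l) (hle : l ≠ e) :
    coeff (tailExp j e q) (umbrellaTail k i j l e q) = 1 := by
  rw [umbrellaTail_eq_sum, coeff_add, coeff_add, coeff_monomial, coeff_monomial, coeff_monomial,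
    if_neg (single_two_ne_tailExp hij hie), if_neg (umbExp_ne_tailExp hjl hle), if_pos rfl, zero_add, zero_add]

/-- Degree of the umbrella exponent (plumbing). [folklore] -/
private theorem degree_umbExp_two₉ (j l : Fin N) : (umbExp j l 2).degree = 3 := by
  rw [umbExp, map_add, Finsupp.degree_single, Finsupp.degree_single]

/-- Degree of the tail exponent (plumbing). [folklore] -/
private theorem degree_tailExp (j e : Fin N) (q : ℕ) : (tailExp j e q).degree = q + 1 := by
  rw [tailExp, map_add, Finsupp.degree_single, Finsupp.degree_single, add_comm]

/-- `X_i`-degree and co-degree of the umbrella exponent (plumbing). [folklore] -/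
private theorem blockDeg_umbExp₉ (hij : i ≠ j) (hil : i ≠ l) : blockDeg {i} (umbExp j l 2) = 0 := by
  rw [blockDeg_singleton, umbExp_two_apply₉, if_neg (Ne.symm hij), if_neg (Ne.symm hil)]

/-- `X_i`-degree and co-degree of the umbrella exponent (plumbing). [folklore] -/
private theorem coDeg_umbExp₉ (hij : i ≠ j) (hil : i ≠ l) : coDeg {i} (umbExp j l 2) = 3 := by
  rw [coDeg_singleton, degree_umbExp_two₉, umbExp_two_apply₉, if_neg (Ne.symm hij), if_neg (Ne.symm hil)]

/-- `X_i`-degree and co-degree of the tail exponent (plumbing). [folklore] -/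
private theorem blockDeg_tailExp (hij : i ≠ j) (hie : i ≠ e) : blockDeg {i} (tailExp j e q) = 0 := by
  rw [blockDeg_singleton, tailExp_apply, if_neg (Ne.symm hij), if_neg (Ne.symm hie)]

/-- `X_i`-degree and co-degree of the tail exponent (plumbing). [folklore] -/
private theorem coDeg_tailExp (hij : i ≠ j) (hie : i ≠ e) : coDeg {i} (tailExp j e q) = q + 1 := by
  rw [coDeg_singleton, degree_tailExp, tailExp_apply, if_neg (Ne.symm hij), if_neg (Ne.symm hie), add_zero,
    Nat.sub_zero]

/-- The germ is non-zero (plumbing). [folklore] -/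
private theorem umbrellaTail_ne_zero (hij : i ≠ j) (hil : i ≠ l) (hie : i ≠ e) (hjl : j ≠ l) :
    umbrellaTail k i j l e q ≠ 0 := by
  intro h0
  have := coeff_single_two_umbrellaTail (k := k) (e := e) (q := q) hij hil hie hjl
  rw [h0, coeff_zero] at this
  exact zero_ne_one this

/-- **The order of `X_i² + X_l X_j² + X_j X_e^q` is `2`** (`q ≥ 1`).
[cite: AbramovichTemkinWlodarczyk2024, §5.1 (p. 1575) (a₁ = ord)] -/
theorem monomialOrd_umbrellaTail (hij : i ≠ j) (hil : i ≠ l) (hie : i ≠ e) (hjl : j ≠ l) (hq : 1 ≤ q) :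
    monomialOrd (fun _ => 1) (umbrellaTail k i j l e q) = 2 := by
  apply le_antisymm
  · have hmem : Finsupp.single i 2 ∈ (umbrellaTail k i j l e q).support := by
      rw [mem_support_iff, coeff_single_two_umbrellaTail hij hil hie hjl]; exact one_ne_zero
    refine (monomialOrd_le_weight (fun _ => 1) hmem).trans ?_
    rw [← Finsupp.degree_eq_weight_one, Finsupp.degree_single]
    simp
  · rw [show (2 : ℕ∞) = ((2 : ℕ) : ℕ∞) from rfl, le_monomialOrd_one_iff]
    intro d hd
    rcases mem_support_umbrellaTail hd with rfl | rfl | rfl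
    · rw [Finsupp.degree_single]
    · rw [degree_umbExp_two₉]; omega
    · rw [degree_tailExp]; omega

/-- **The initial form is `X_i²`** (`q ≠ 1`). [cite: CossartJannsenSaito2020, Def. 8.2 (p. 118) (in_ν f)] -/
theorem homogeneousComponent_umbrellaTail (hq : q ≠ 1) :
    homogeneousComponent 2 (umbrellaTail k i j l e q) = X i ^ 2 := by
  rw [umbrellaTail, map_add, homogeneousComponent_umbrella (by norm_num),
    homogeneousComponent_of_mem ((isHomogeneous_X k j).mul (isHomogeneous_X_pow e q)), if_neg (by omega),
    add_zero]

/-- `3/2` is not a natural number (plumbing). [folklore] -/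
private theorem natCast_ne_three_halves₉ (n : ℕ) : (n : ℚ) ≠ 3 / 2 := by
  intro h
  have h2 : (2 * n : ℕ) = (3 : ℕ) := by
    have : (2 : ℚ) * n = 3 := by rw [h]; norm_num
    exact_mod_cast this
  omega

/-- **Hironaka's `δ` with respect to `X_i` is `3/2`** (`q ≥ 2`): the points of the polyhedron are `3/2`
(from `X_j² X_l`) and `(q+1)/2` (from `X_j X_e^q`). [cite: CossartJannsenSaito2020, Def. 8.2 (1) (p. 118)] -/
theorem hironakaDelta_umbrellaTail (hij : i ≠ j) (hil : i ≠ l) (hie : i ≠ e) (hjl : j ≠ l) (hle : l ≠ e)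
    (hq : 2 ≤ q) :
    hironakaDelta {i} 2 (umbrellaTail k i j l e q) = (((3 : ℚ) / 2 : ℚ) : WithTop ℚ) := by
  classical
  apply le_antisymm
  · unfold hironakaDelta
    have hmem : umbExp j l 2 ∈ (umbrellaTail k i j l e q).support := by
      rw [mem_support_iff, coeff_umbExp_umbrellaTail hil hjl hle]; exact one_ne_zero
    refine (Finset.inf_le (Finset.mem_filter.2 ⟨hmem, ?_⟩)).trans ?_
    · rw [blockDeg_umbExp₉ hij hil]; exact two_pos
    · rw [blockDeg_umbExp₉ hij hil, coDeg_umbExp₉ hij hil]; norm_num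
  · rw [le_hironakaDelta_iff]
    intro d hd hb
    rcases mem_support_umbrellaTail hd with rfl | rfl | rfl
    · rw [blockDeg_singleton, Finsupp.single_eq_same] at hb; exact (lt_irrefl _ hb).elim
    · rw [blockDeg_umbExp₉ hij hil, coDeg_umbExp₉ hij hil]; norm_num
    · rw [blockDeg_tailExp hij hie, coDeg_tailExp hij hie, Nat.sub_zero]
      have : (2 : ℚ) ≤ q := by exact_mod_cast hq
      push_cast
      linarith

/-- `δ = 3/2 ∉ ℕ`, so the germ is `δ`-prepared with respect to `X_i` for free (`q ≥ 2`). (derived here)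
[cite: CossartJannsenSaito2020, Thm. 8.22 (a) (p. 124) (solvable vertices are integral)] -/
theorem isDeltaPrepared_umbrellaTail (hij : i ≠ j) (hil : i ≠ l) (hie : i ≠ e) (hjl : j ≠ l) (hle : l ≠ e)
    (hq : 2 ≤ q) : IsDeltaPrepared {i} 2 (umbrellaTail k i j l e q) := by
  intro v _ hv
  exfalso
  rw [hironakaDelta_umbrellaTail hij hil hie hjl hle hq, WithTop.coe_eq_coe] at hv
  exact natCast_ne_three_halves₉ v.degree hv

/-- **The `δ`-initial form with respect to `X_i` is the umbrella `X_i² + X_j² X_l`** (`q ≠ 2`: the tail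
`X_j X_e^q` is off the `δ`-face). (derived here) [cite: CossartJannsenSaito2020, Def. 8.2 (4) (p. 118) (in_δ)] -/
theorem deltaInitial_umbrellaTail (hij : i ≠ j) (hil : i ≠ l) (hie : i ≠ e) (hjl : j ≠ l) (hle : l ≠ e)
    (hq2 : q ≠ 2) :
    deltaInitial {i} 2 ((3 : ℚ) / 2) (umbrellaTail k i j l e q) = umbrella k i j l 2 2 := by
  classical
  unfold deltaInitial
  have hfilter : ((umbrellaTail k i j l e q).support.filter fun d =>
      blockDeg {i} d ≤ 2 ∧ (coDeg {i} d : ℚ) = 3 / 2 * ((2 - blockDeg {i} d : ℕ) : ℚ)) =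
      {Finsupp.single i 2, umbExp j l 2} := by
    ext d
    simp only [Finset.mem_filter, Finset.mem_insert, Finset.mem_singleton]
    constructor
    · rintro ⟨hd, hb, hc⟩
      rcases mem_support_umbrellaTail hd with rfl | rfl | rfl
      · exact Or.inl rfl
      · exact Or.inr rfl
      · exfalso
        rw [blockDeg_tailExp hij hie, coDeg_tailExp hij hie, Nat.sub_zero] at hc
        apply hq2
        have h3 : ((q + 1 : ℕ) : ℚ) = (3 : ℕ) := by rw [hc]; norm_num
        have h3' : q + 1 = 3 := by exact_mod_cast h3
        omega
    · rintro (rfl | rfl)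
      · refine ⟨?_, ?_, ?_⟩
        · rw [mem_support_iff, coeff_single_two_umbrellaTail hij hil hie hjl]; exact one_ne_zero
        · rw [blockDeg_singleton, Finsupp.single_eq_same]
        · rw [blockDeg_singleton, coDeg_singleton, Finsupp.degree_single, Finsupp.single_eq_same]; norm_num
      · refine ⟨?_, ?_, ?_⟩
        · rw [mem_support_iff, coeff_umbExp_umbrellaTail hil hjl hle]; exact one_ne_zero
        · rw [blockDeg_umbExp₉ hij hil]; norm_num
        · rw [blockDeg_umbExp₉ hij hil, coDeg_umbExp₉ hij hil]; norm_num
  rw [hfilter, Finset.sum_pair (single_two_ne_umbExp₉ hil hjl), coeff_single_two_umbrellaTail hij hil hie hjl,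
    coeff_umbExp_umbrellaTail hil hjl hle, umbrella_two_eq₉]

end Germ

/-! ## §2 The coordinate centre `(X_i², X_j³, X_l³, X_e^{3q/2})`: `(2, 3, 3, 3q/2) ∈ W` -/

section Centre

variable {i j l e : Fin N} {q : ℕ}

/-- The cocharacter of the coordinate centre `(X_i², X_j³, X_l³, X_e^{3q/2})`: weights `1/2, 1/3, 1/3` and
`2/(3q)` on `X_e` (so that `X_j X_e^q` has value `1/3 + 2/3 = 1`). [cite: AbramovichTemkinWlodarczyk2024,
§5.1 (p. 1575)] -/
def umbrellaTailWeights (i j l e : Fin N) (q : ℕ) : Fin N → ℚ := fun x =>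
  if x = i then 1 / 2 else if x = j ∨ x = l then 1 / 3 else if x = e then 2 / (3 * (q : ℚ)) else 0

/-- Values of the cocharacter (plumbing). [folklore] -/
private theorem umbrellaTailWeights_i : umbrellaTailWeights i j l e q i = 1 / 2 := by
  simp [umbrellaTailWeights]

/-- Values of the cocharacter (plumbing). [folklore] -/
private theorem umbrellaTailWeights_j (hij : i ≠ j) : umbrellaTailWeights i j l e q j = 1 / 3 := by
  simp [umbrellaTailWeights, hij.symm]

/-- Values of the cocharacter (plumbing). [folklore] -/
private theorem umbrellaTailWeights_l (hil : i ≠ l) : umbrellaTailWeights i j l e q l = 1 / 3 := by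
  simp [umbrellaTailWeights, hil.symm]

/-- Values of the cocharacter (plumbing). [folklore] -/
private theorem umbrellaTailWeights_e (hie : i ≠ e) (hje : j ≠ e) (hle : l ≠ e) :
    umbrellaTailWeights i j l e q e = 2 / (3 * (q : ℚ)) := by
  simp [umbrellaTailWeights, hie.symm, hje.symm, hle.symm]

/-- Values of the cocharacter (plumbing). [folklore] -/
private theorem umbrellaTailWeights_of_ne {x : Fin N} (h1 : x ≠ i) (h2 : x ≠ j) (h3 : x ≠ l) (h4 : x ≠ e) :
    umbrellaTailWeights i j l e q x = 0 := by
  simp [umbrellaTailWeights, h1, h2, h3, h4]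

/-- `exps` of the cocharacter is `[2, 3, 3, 3q/2]` (`q ≥ 2`). (derived here)
[cite: AbramovichTemkinWlodarczyk2024, §5.1 (p. 1575) (invariant (a₁,…,a_k) of the centre)] -/
theorem exps_umbrellaTailWeights (hij : i ≠ j) (hil : i ≠ l) (hie : i ≠ e) (hjl : j ≠ l) (hje : j ≠ e)
    (hle : l ≠ e) (hq : 2 ≤ q) :
    exps (umbrellaTailWeights i j l e q) = [(2 : ℚ), 3, 3, 3 * (q : ℚ) / 2] := by
  classical
  have hq0 : (q : ℚ) ≠ 0 := by exact_mod_cast (show q ≠ 0 by omega)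
  have hE0 : (2 : ℚ) / (3 * (q : ℚ)) ≠ 0 := div_ne_zero two_ne_zero (mul_ne_zero three_ne_zero hq0)
  have hfilter : (Finset.univ.filter fun x => umbrellaTailWeights i j l e q x ≠ 0) = {i, j, l, e} := by
    ext x
    simp only [Finset.mem_filter, Finset.mem_univ, true_and, Finset.mem_insert, Finset.mem_singleton]
    constructor
    · intro hx
      by_contra hne
      push Not at hne
      exact hx (umbrellaTailWeights_of_ne hne.1 hne.2.1 hne.2.2.1 hne.2.2.2)
    · rintro (rfl | rfl | rfl | rfl)
      · rw [umbrellaTailWeights_i]; norm_num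
      · rw [umbrellaTailWeights_j hij]; norm_num
      · rw [umbrellaTailWeights_l hil]; norm_num
      · rw [umbrellaTailWeights_e hie hje hle]; exact hE0
  have h4 : (({i, j, l, e} : Finset (Fin N)).toList).Perm [i, j, l, e] :=
    (Finset.toList_insert (by simp [hij, hil, hie])).trans
      (List.Perm.cons _ ((Finset.toList_insert (by simp [hjl, hje])).trans
        (List.Perm.cons _ ((Finset.toList_insert (by simp [hle])).trans
          (List.Perm.of_eq (by rw [Finset.toList_singleton]))))))
  have hperm : (exps (umbrellaTailWeights i j l e q)).Perm [(2 : ℚ), 3, 3, 3 * (q : ℚ) / 2] := by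
    unfold exps
    refine (List.perm_insertionSort _ _).trans ?_
    rw [hfilter]
    refine (h4.map _).trans (List.Perm.of_eq ?_)
    simp only [List.map_cons, List.map_nil, umbrellaTailWeights_i, umbrellaTailWeights_j hij,
      umbrellaTailWeights_l hil, umbrellaTailWeights_e hie hje hle, inv_div, inv_inv, one_div]
  have hsorted : [(2 : ℚ), 3, 3, 3 * (q : ℚ) / 2].Pairwise (· ≤ ·) := by
    have hq' : (2 : ℚ) ≤ q := by exact_mod_cast hq
    have h3 : (3 : ℚ) ≤ 3 * (q : ℚ) / 2 := by linarith
    have h2 : (2 : ℚ) ≤ 3 * (q : ℚ) / 2 := by linarith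
    simp only [List.pairwise_cons, List.mem_cons, List.not_mem_nil, List.Pairwise.nil, forall_eq_or_imp,
      forall_eq, or_false, and_true, IsEmpty.forall_iff, implies_true]
    refine ⟨⟨by norm_num, by norm_num, h2⟩, ⟨le_rfl, h3⟩, h3⟩
  exact hperm.eq_of_sortedLE (exps_sorted _).sortedLE hsorted.sortedLE

/-- The coordinate centre `(X_i², X_j³, X_l³, X_e^{3q/2})` is admissible (`Ψ = id`, `q ≠ 0`). (derived here)
[cite: AbramovichTemkinWlodarczyk2024, §5.1 (p. 1575) and Rem. 5.2.3 (admissibility via v_J)] -/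
theorem isCentreFor_umbrellaTailWeights (hij : i ≠ j) (hil : i ≠ l) (hie : i ≠ e) (hje : j ≠ e) (hle : l ≠ e)
    (hq : q ≠ 0) :
    IsCentreFor (umbrellaTail k i j l e q) AlgEquiv.refl (umbrellaTailWeights i j l e q) := by
  have hq0 : (q : ℚ) ≠ 0 := by exact_mod_cast hq
  refine ⟨fun x => constantCoeff_X k x, fun x => ?_, fun d hd => ?_⟩
  · unfold umbrellaTailWeights
    split_ifs
    · norm_num
    · norm_num
    · positivity
    · exact le_rfl
  · change d ∈ (umbrellaTail k i j l e q).support at hd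
    rcases mem_support_umbrellaTail hd with rfl | rfl | rfl
    · rw [monomialValuation, Finsupp.sum_single_index (by simp), umbrellaTailWeights_i]; norm_num
    · rw [umbExp, monomialValuation, Finsupp.sum_add_index' (by simp) (by intros; simp [add_mul]),
        Finsupp.sum_single_index (by simp), Finsupp.sum_single_index (by simp), umbrellaTailWeights_j hij,
        umbrellaTailWeights_l hil]
      norm_num
    · rw [tailExp, monomialValuation, Finsupp.sum_add_index' (by simp) (by intros; simp [add_mul]),
        Finsupp.sum_single_index (by simp), Finsupp.sum_single_index (by simp), umbrellaTailWeights_j hij,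
        umbrellaTailWeights_e hie hje hle]
      have h : (q : ℚ) * (2 / (3 * (q : ℚ))) = 2 / 3 := by
        rw [mul_div_assoc', mul_comm (q : ℚ) 2, mul_div_mul_right _ _ hq0]
      rw [h]; norm_num

/-- **`(2, 3, 3, 3q/2) ∈ W(X_i² + X_l X_j² + X_j X_e^q)`** (`q ≥ 2`). (derived here)
[cite: AbramovichTemkinWlodarczyk2024, §5.1 (p. 1575)] -/
theorem umbrellaTail_inv_mem (hij : i ≠ j) (hil : i ≠ l) (hie : i ≠ e) (hjl : j ≠ l) (hje : j ≠ e)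
    (hle : l ≠ e) (hq : 2 ≤ q) :
    [(2 : ℚ), 3, 3, 3 * (q : ℚ) / 2] ∈ admissibleInvariants (umbrellaTail k i j l e q) := by
  rw [← exps_umbrellaTailWeights hij hil hie hjl hje hle hq]
  exact exps_mem_admissibleInvariants (isCentreFor_umbrellaTailWeights hij hil hie hje hle (by omega))

end Centre

/-! ## §3 The first face: no invariant above `(2, 3, 3)` — general form and the tail germ -/

section FirstFace

/-- Every non-zero weight contributes its inverse to `exps` (plumbing). [folklore] -/
private theorem inv_mem_exps_of_ne_zero₉ {γ : Fin N → ℚ} {x : Fin N} (hx : γ x ≠ 0) : (γ x)⁻¹ ∈ exps γ := by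
  classical
  unfold exps
  rw [List.mem_insertionSort, List.mem_map]
  exact ⟨x, Finset.mem_toList.2 (Finset.mem_filter.2 ⟨Finset.mem_univ _, hx⟩), rfl⟩

/-- Heads of sorted lists (plumbing). [folklore] -/
private theorem le_of_mem_of_pairwise₉ {a x : ℚ} {es : List ℚ} (hs : (a :: es).Pairwise (· ≤ ·))
    (hx : x ∈ a :: es) : a ≤ x := by
  rcases List.mem_cons.1 hx with rfl | hx
  · exact le_rfl
  · exact (List.pairwise_cons.1 hs).1 x hx

/-- A sorted list with an entry `≤ θ` starts with one (plumbing). [folklore] -/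
private theorem head_le_of_countP_pos₉ {θ a : ℚ} {es : List ℚ} (hs : (a :: es).Pairwise (· ≤ ·))
    (h : 0 < (a :: es).countP fun x => decide (x ≤ θ)) : a ≤ θ := by
  obtain ⟨x, hx, hxθ⟩ := List.countP_pos_iff.1 h
  exact (le_of_mem_of_pairwise₉ hs hx).trans (by simpa using hxθ)

/-- Order bookkeeping for `[a, θ, θ]` (plumbing). [folklore] -/
private theorem not_lt_triple_of_snd_lt₉ {a θ e₂ : ℚ} {rest : List ℚ} (h : e₂ < θ) :
    ¬ ATW.TruncLex.lt [a, θ, θ] (a :: e₂ :: rest) := by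
  rw [ATW.TruncLex.cons_lt_cons, ATW.TruncLex.cons_lt_cons]
  rintro (h1 | ⟨-, h2 | ⟨h3, -⟩⟩)
  · exact lt_irrefl _ h1
  · exact lt_asymm h h2
  · exact h.ne' h3

/-- Order bookkeeping for `[a, θ, θ]` (plumbing). [folklore] -/
private theorem not_lt_triple_of_third_le₉ {a θ e₃ : ℚ} {rest : List ℚ} (h : e₃ ≤ θ) :
    ¬ ATW.TruncLex.lt [a, θ, θ] (a :: θ :: e₃ :: rest) := by
  rw [ATW.TruncLex.cons_lt_cons, ATW.TruncLex.cons_lt_cons, ATW.TruncLex.cons_lt_cons]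
  rintro (h1 | ⟨-, h2 | ⟨-, h3 | ⟨-, h4⟩⟩⟩)
  · exact lt_irrefl _ h1
  · exact lt_irrefl _ h2
  · exact not_lt.2 h h3
  · exact ATW.TruncLex.not_nil_lt _ h4

/-- Counting bookkeeping for the variables of weight `≥ 1/M` (plumbing). [folklore] -/
private theorem one_add_card_le_card_filter₉ {γ : Fin N → ℚ} {i : Fin N} {P M : ℚ} (hP : 0 < P)
    (hPM : P ≤ M) (hM : 0 < M) (hγi : γ i = P⁻¹) :
    1 + (Finset.univ.filter fun x => x ∉ ({i} : Finset (Fin N)) ∧ γ x = M⁻¹).card ≤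
      (Finset.univ.filter fun x => γ x ≠ 0 ∧ (γ x)⁻¹ ≤ M).card := by
  rw [add_comm, ← Finset.card_insert_of_notMem
    (s := Finset.univ.filter fun x => x ∉ ({i} : Finset (Fin N)) ∧ γ x = M⁻¹) (a := i) (by simp)]
  refine Finset.card_le_card fun x hx => ?_
  rw [Finset.mem_insert] at hx
  rw [Finset.mem_filter]
  refine ⟨Finset.mem_univ _, ?_⟩
  rcases hx with rfl | hx
  · rw [hγi, inv_inv]; exact ⟨inv_ne_zero hP.ne', hPM⟩
  · rw [Finset.mem_filter] at hx
    rw [hx.2.2, inv_inv]; exact ⟨inv_ne_zero hM.ne', le_rfl⟩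

/-- **First face, general form: nothing in `W(f)` is above `(2, 3, 3)`** whenever `ord f = 2`,
`in₂ f = X_i²`, Hironaka's `δ(f; X_i) = 3/2` (so `f` is `δ`-prepared for free) and the `δ`-initial form has
`τ = 3` — EVERY characteristic, any number of variables, ALL polynomial coordinate changes: for every
`b ∈ W(f)`, `b₁ ≤ 2`, `b₁ = 2 ⇒ b₂ ≤ 3`, and `(b₁, b₂) = (2, 3) ⇒ b` has a third entry `≤ 3`.  (derived
here from the vertex theorems of `WeightedCentreVertexPreparation`; abstracts the argument of
`WeightedCentreUmbrellaPowBound`) [cite: AbramovichTemkinWlodarczyk2024, Thm. 5.3.1 (2) (p. 1578) (inv =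
max over admissible centres)] [cite: CossartJannsenSaito2020, Thm. 8.16 (p. 121) (δ-prepared polyhedron
computes the invariant), Thm. 8.22 (a) (p. 124)] -/
theorem not_lt_233_of_mem_admissibleInvariants {f : MvPolynomial (Fin N) k} {i : Fin N}
    (hord : monomialOrd (fun _ => 1) f = 2) (hin : homogeneousComponent 2 f = X i ^ 2)
    (hδ : hironakaDelta {i} 2 f = (((3 : ℚ) / 2 : ℚ) : WithTop ℚ)) (hprep : IsDeltaPrepared {i} 2 f)
    (hτδ : hironakaTau k {deltaInitial {i} 2 ((3 : ℚ) / 2) f} = 3) {b : List ℚ}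
    (hb : b ∈ admissibleInvariants f) : ¬ ATW.TruncLex.lt [(2 : ℚ), 3, 3] b := by
  classical
  have hpδ : ((2 : ℕ) : ℚ) * ((3 : ℚ) / 2) = 3 := by norm_num
  have hτ : ({i} : Finset (Fin N)).card = hironakaTau k {homogeneousComponent 2 f} := by
    rw [hin, hironakaTau_X_pow i two_ne_zero, Finset.card_singleton]
  have hFS : ∀ d ∈ (homogeneousComponent 2 f).support, ∀ x ∉ ({i} : Finset (Fin N)), d x = 0 := by
    intro d hd x hx
    rw [hin, X_pow_eq_monomial] at hd
    have hd' := Finset.mem_singleton.1 (support_monomial_subset hd)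
    rw [Finset.mem_singleton] at hx
    rw [hd', Finsupp.single_apply, if_neg (Ne.symm hx)]
  have hδint : ∀ n : ℕ, (n : ℚ) ≠ 3 / 2 := natCast_ne_three_halves₉
  obtain ⟨Ψ, γ, h, rfl⟩ := hb
  have hsorted := exps_sorted γ
  have hγpos : ∀ x, γ x ≠ 0 → 0 < γ x := fun x hx => lt_of_le_of_ne (h.2.1 x) (Ne.symm hx)
  by_cases hle' : ∀ x, γ x ≤ ((2 : ℕ) : ℚ)⁻¹
  · -- `[2]` is a prefix of `exps γ`, and at least two entries are `≤ 3`
    obtain ⟨es, hes⟩ : ∃ es, exps γ = ((2 : ℕ) : ℚ) :: es := by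
      obtain ⟨t, ht⟩ := replicate_prefix_of_forall_le hord h hle'
      rw [← hτ, Finset.card_singleton, List.replicate_one] at ht
      exact ⟨t, ht.symm⟩
    have hcount := succ_card_le_countP_exps_of_isDeltaPrepared hord hτ hFS hprep hδ h hle'
    rw [Finset.card_singleton, hpδ, hes, List.countP_cons_of_pos (by norm_num)] at hcount
    rw [hes] at hsorted
    obtain ⟨e₂, es', rfl⟩ : ∃ e₂ es', es = e₂ :: es' := by
      cases es with
      | nil => simp at hcount
      | cons e₂ es' => exact ⟨e₂, es', rfl⟩
    have hs₂ : (e₂ :: es').Pairwise (· ≤ ·) := (List.pairwise_cons.1 hsorted).2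
    have he₂ : e₂ ≤ 3 := head_le_of_countP_pos₉ hs₂ (by omega)
    rw [hes, Nat.cast_two]
    by_cases heq₂ : e₂ = 3
    swap
    · exact not_lt_triple_of_snd_lt₉ (lt_of_le_of_ne he₂ heq₂)
    rw [heq₂] at hes hs₂ ⊢
    -- exactly one entry of `exps γ` is `≤ 2`: the variable `x₀` of weight `1/2`
    have hes' : ∀ x ∈ es', 3 ≤ x := (List.pairwise_cons.1 hs₂).1
    have hcountp : (exps γ).countP (fun x => decide (x ≤ (2 : ℚ))) = 1 := by
      rw [hes, Nat.cast_two, List.countP_cons_of_pos (by simp), List.countP_cons_of_neg (by norm_num),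
        List.countP_eq_zero.2 (fun x hx => by
          have := hes' x hx
          simp only [decide_eq_true_eq, not_le]; linarith)]
    rw [countP_exps] at hcountp
    obtain ⟨x₀, hx₀⟩ := Finset.card_eq_one.1 hcountp
    have hx₀' : γ x₀ ≠ 0 ∧ (γ x₀)⁻¹ ≤ (2 : ℚ) := by
      have : x₀ ∈ ({x₀} : Finset (Fin N)) := Finset.mem_singleton_self x₀
      rw [← hx₀, Finset.mem_filter] at this
      exact this.2
    have hγx₀ : γ x₀ = (2 : ℚ)⁻¹ := by
      refine le_antisymm (by simpa using hle' x₀) (inv_le_of_inv_le₀ (hγpos x₀ hx₀'.1) hx₀'.2)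
    have hothers : ∀ x, x ≠ x₀ → γ x ≤ (3 : ℚ)⁻¹ := by
      intro x hx
      by_cases h0 : γ x = 0
      · rw [h0]; norm_num
      have hnot : ¬ (γ x)⁻¹ ≤ (2 : ℚ) := by
        intro hle''
        apply hx
        have : x ∈ ({x₀} : Finset (Fin N)) := by
          rw [← hx₀, Finset.mem_filter]; exact ⟨Finset.mem_univ _, h0, hle''⟩
        exact Finset.mem_singleton.1 this
      have hmem := inv_mem_exps_of_ne_zero₉ h0
      rw [hes, List.mem_cons] at hmem
      rcases hmem with heq | hmem
      · exfalso; apply hnot; rw [heq]; norm_num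
      · exact le_inv_of_le_inv₀ (by norm_num) (le_of_mem_of_pairwise₉ hs₂ hmem)
    -- move `x₀` to `i` and count the variables of weight exactly `1/3`
    set π : Equiv.Perm (Fin N) := Equiv.swap i x₀ with hπ
    have h' := h.perm π
    have hπi : π i = x₀ := Equiv.swap_apply_left i x₀
    have hπne : ∀ x, x ≠ i → π x ≠ x₀ := by
      intro x hx heq
      apply hx
      apply π.injective
      rw [heq, hπi]
    have hγS : ∀ x ∈ ({i} : Finset (Fin N)), (γ ∘ π) x = ((2 : ℕ) : ℚ)⁻¹ := by
      intro x hx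
      rw [Finset.mem_singleton] at hx
      rw [hx, Function.comp_apply, hπi, hγx₀, Nat.cast_two]
    have hγle : ∀ x ∉ ({i} : Finset (Fin N)), (γ ∘ π) x ≤ (((2 : ℕ) : ℚ) * ((3 : ℚ) / 2))⁻¹ := by
      intro x hx
      rw [Finset.mem_singleton] at hx
      rw [hpδ, Function.comp_apply]
      exact hothers _ (hπne x hx)
    have hbound := hironakaTau_deltaInitial_le_of_forall_natCast_ne hord hτ hFS hprep hδ hδint h' hγS hγle
    rw [hτδ, Finset.card_singleton, hpδ] at hbound
    have hcnt : 3 ≤ (exps (γ ∘ π)).countP (fun x => decide (x ≤ (3 : ℚ))) := by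
      rw [countP_exps]
      exact hbound.trans (one_add_card_le_card_filter₉ (P := 2) (by norm_num) (by norm_num) (by norm_num)
        (by rw [Function.comp_apply, hπi, hγx₀]))
    rw [exps_comp_perm, hes, Nat.cast_two, List.countP_cons_of_pos (by norm_num),
      List.countP_cons_of_pos (by simp)] at hcnt
    cases es' with
    | nil => simp at hcnt
    | cons e₃ es'' =>
      have hs₃ : (e₃ :: es'').Pairwise (· ≤ ·) := (List.pairwise_cons.1 hs₂).2
      exact not_lt_triple_of_third_le₉ (head_le_of_countP_pos₉ hs₃ (by omega))
  · -- some weight exceeds `1/2`: then the head of `exps γ` is `< 2`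
    push Not at hle'
    obtain ⟨x, hx⟩ := hle'
    rw [Nat.cast_two] at hx
    have hγx : γ x ≠ 0 := (lt_trans (by norm_num) hx).ne'
    have hlt : (γ x)⁻¹ < 2 := inv_lt_of_inv_lt₀ (by norm_num) hx
    have hmem := inv_mem_exps_of_ne_zero₉ hγx
    obtain ⟨a, es, hes⟩ : ∃ a es, exps γ = a :: es := by
      cases hq' : exps γ with
      | nil => rw [hq'] at hmem; simp at hmem
      | cons a es => exact ⟨a, es, rfl⟩
    rw [hes] at hmem hsorted ⊢
    have ha : a < 2 := (le_of_mem_of_pairwise₉ hsorted hmem).trans_lt hlt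
    rw [ATW.TruncLex.cons_lt_cons]
    rintro (h1 | ⟨h2, -⟩)
    · exact lt_asymm ha h1
    · exact ha.ne' h2

variable {i j l e : Fin N} {q : ℕ}

/-- **First face of the tail germ: no invariant of `X_i² + X_l X_j² + X_j X_e^q` is above `(2, 3, 3)`**
(`q ≥ 3`, `i, j, l, e` distinct, spectators allowed, EVERY characteristic, ALL polynomial coordinate
changes). (derived here) [cite: AbramovichTemkinWlodarczyk2024, Thm. 5.3.1 (2) (p. 1578);
CossartJannsenSaito2020, Thm. 8.16 (p. 121), Thm. 8.22 (a) (p. 124)] -/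
theorem not_lt_of_mem_admissibleInvariants_umbrellaTail (hij : i ≠ j) (hil : i ≠ l) (hie : i ≠ e)
    (hjl : j ≠ l) (hle : l ≠ e) (hq : 3 ≤ q) {b : List ℚ}
    (hb : b ∈ admissibleInvariants (umbrellaTail k i j l e q)) :
    ¬ ATW.TruncLex.lt [(2 : ℚ), 3, 3] b :=
  not_lt_233_of_mem_admissibleInvariants (monomialOrd_umbrellaTail hij hil hie hjl (by omega))
    (homogeneousComponent_umbrellaTail (by omega)) (hironakaDelta_umbrellaTail hij hil hie hjl hle (by omega))
    (isDeltaPrepared_umbrellaTail hij hil hie hjl hle (by omega))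
    (by
      rw [deltaInitial_umbrellaTail hij hil hie hjl hle (by omega)]
      exact hironakaTau_umbrella hij hil hjl two_ne_zero two_ne_zero)
    hb

end FirstFace

/-! ## §4 The endgame on an axis for the tail germ (pure `k[T]` algebra) -/

section Endgame

/-- The constant coefficient of a power (plumbing). [folklore] -/
private theorem coeff_zero_pow₉ (P : Polynomial k) (m : ℕ) : (P ^ m).coeff 0 = P.coeff 0 ^ m := by
  simp [Polynomial.coeff_zero_eq_eval_zero]

/-- A polynomial with vanishing `T⁰, T¹`-coefficients vanishes below order `2` (plumbing).
[cite: CossartJannsenSaito2020, Def. 1.26 (order along `T = 0`)] -/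
private theorem vanBelow_two_of_coeff {P : Polynomial k} (h0 : P.coeff 0 = 0) (h1 : P.coeff 1 = 0) :
    VanBelow 2 P := by
  intro n hn
  have hn2 : n < 2 := by exact_mod_cast hn
  interval_cases n
  · exact h0
  · exact h1

/-- **Axis endgame for the tail germ.**  Let `V, U, Z ∈ k[T]` vanish at `0`, `L(0) ≠ 0`, `3 ≤ q`, `3q/2 < c`,
and assume the six vanishing statements extracted from the admissibility of a centre of weights
`(1/2, 1/3, 1/3, ≤ 1/c, …)` for `V² + U W² + W Z^q` along a light axis (orders `c`, `c/2`, `2c/3`, `2c/3`,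
`c/3`, `c/3` for `f`, `∂_v f`, `ξ_u f`, `ξ_w f`, `ξ_u² f/2`, `ξ_w² f/2`).  If `2 = 0` in `k`, or `q ≤ 4`, then
the LINEAR coefficients of `V, W, U, Z` all vanish: the `ε¹`-slice of `ξ_w` contains `L Z^q`, whose
`T^q`-coefficient is `L(0) Z₁^q`. (derived here; the heart of the second-vertex theorem for the tail)
[cite: AbramovichTemkinWlodarczyk2024, Thm. 5.3.1 (2) (p. 1578), Lemma 5.2.10 (p. 1577);
Temkin2025, §1.2.2 (1) (p. 4)] -/
theorem axis_endgame_tail {V W U Z L A B : Polynomial k} {c : ℚ} {q : ℕ} (hq : 3 ≤ q)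
    (hqc : 3 * (q : ℚ) / 2 < c) (h2q : (2 : k) = 0 ∨ q ≤ 4) (hL : L.coeff 0 ≠ 0)
    (hV0 : V.coeff 0 = 0) (hU0 : U.coeff 0 = 0) (hZ0 : Z.coeff 0 = 0)
    (hZ : VanBelow c (V ^ 2 + U * W ^ 2 + W * Z ^ q))
    (hEv : VanBelow (c / 2) (2 * V))
    (hE1u : VanBelow (2 * c / 3) (L * W ^ 2 - 2 * V * A))
    (hE1w : VanBelow (2 * c / 3) (2 * L * U * W + L * Z ^ q - 2 * V * B))
    (hE2u : VanBelow (c / 3) (A ^ 2))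
    (hE2w : VanBelow (c / 3) (B ^ 2 + L ^ 2 * U)) :
    V.coeff 1 = 0 ∧ W.coeff 1 = 0 ∧ U.coeff 1 = 0 ∧ Z.coeff 1 = 0 := by
  have hq' : (3 : ℚ) ≤ q := by exact_mod_cast hq
  have hc9 : (9 : ℚ) / 2 < c := by linarith
  -- (1) `W` has order `≥ c/3`
  have hA : VanBelow (c / 6) A := by
    have := hE2u.of_sq; rwa [show c / 3 / 2 = c / 6 by ring] at this
  have hVA : VanBelow (2 * c / 3) (2 * V * A) := by
    have := hEv.mul hA; rwa [show c / 2 + c / 6 = 2 * c / 3 by ring] at this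
  have hLW2 : VanBelow (2 * c / 3) (L * W ^ 2) := by
    have := hE1u.add hVA; rwa [sub_add_cancel] at this
  have hW2 : VanBelow (2 * c / 3) (W ^ 2) := hLW2.of_mul_left hL
  have hW : VanBelow (c / 3) W := by
    have := hW2.of_sq; rwa [show 2 * c / 3 / 2 = c / 3 by ring] at this
  have hW1 : W.coeff 1 = 0 := hW 1 (by rw [Nat.cast_one]; linarith)
  -- (2) `V₁ = 0` from the `T²`-coefficient of `V² + U W² + W Z^q`
  have hZq : VanBelow q (Z ^ q) := by
    have := (vanBelow_one_of_coeff_zero hZ0).pow q; rwa [mul_one] at this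
  have hV1 : V.coeff 1 = 0 := by
    have h2 := hZ 2 (by norm_num; linarith)
    have hUW : (U * W ^ 2).coeff 2 = 0 := (hW2.mul_left U) 2 (by norm_num; linarith)
    have hWZ : (W * Z ^ q).coeff 2 = 0 := (hZq.mul_left W) 2 (by exact_mod_cast (show 2 < q by omega))
    rw [Polynomial.coeff_add, Polynomial.coeff_add, hUW, hWZ, add_zero, add_zero, pow_two, Polynomial.coeff_mul,
      Finset.Nat.sum_antidiagonal_eq_sum_range_succ_mk] at h2
    simp only [Finset.sum_range_succ, Finset.sum_range_zero, hV0, zero_mul, mul_zero, zero_add, add_zero] at h2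
    exact pow_eq_zero_iff two_ne_zero |>.1 (by rw [pow_two]; exact h2)
  -- (3) `B(0) = 0` and `U₁ = 0` from the `T⁰, T¹`-coefficients of `B² + L² U`
  have hB0 : B.coeff 0 = 0 := by
    have h := hE2w 0 (by rw [Nat.cast_zero]; linarith)
    rw [Polynomial.coeff_add, Polynomial.mul_coeff_zero, hU0, mul_zero, add_zero, coeff_zero_pow₉] at h
    exact pow_eq_zero_iff two_ne_zero |>.1 h
  have hU1 : U.coeff 1 = 0 := by
    have h := hE2w 1 (by rw [Nat.cast_one]; linarith)
    have hB2 : (B ^ 2).coeff 1 = 0 := ((vanBelow_one_of_coeff_zero hB0).pow 2) 1 (by norm_num)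
    have hLU : (L ^ 2 * U).coeff 1 = L.coeff 0 ^ 2 * U.coeff 1 := by
      rw [Polynomial.coeff_mul, Finset.Nat.sum_antidiagonal_eq_sum_range_succ_mk]
      simp only [Finset.sum_range_succ, Finset.sum_range_zero, hU0, mul_zero, zero_add, add_zero,
        coeff_zero_pow₉]
    rw [Polynomial.coeff_add, hB2, zero_add, hLU] at h
    exact (mul_eq_zero.1 h).resolve_left (pow_ne_zero 2 hL)
  refine ⟨hV1, hW1, hU1, ?_⟩
  -- (4) `Z₁ = 0`: the `T^q`-coefficient of `L Z^q` is `L(0) Z₁^q`, and it vanishes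
  obtain ⟨Z', hZ'⟩ : Polynomial.X ∣ Z := Polynomial.X_dvd_iff.2 hZ0
  have hμ : Z'.coeff 0 = Z.coeff 1 := by rw [hZ']; simp
  have eLZ : L * Z ^ q = Polynomial.X ^ q * (L * Z' ^ q) := by rw [hZ']; ring
  have hLZq_q : (L * Z ^ q).coeff q = L.coeff 0 * Z.coeff 1 ^ q := by
    rw [eLZ, Polynomial.coeff_X_pow_mul', if_pos le_rfl, Nat.sub_self, Polynomial.mul_coeff_zero, coeff_zero_pow₉,
      hμ]
  have hq23 : (q : ℚ) < 2 * c / 3 := by linarith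
  suffices hcoef : (L * Z ^ q).coeff q = 0 by
    rw [hLZq_q] at hcoef
    exact pow_eq_zero_iff (by omega : q ≠ 0) |>.1 ((mul_eq_zero.1 hcoef).resolve_left hL)
  rcases h2q with h2 | hq4
  · -- characteristic `2`: `L Z^q` is the whole `ε¹`-slice of `ξ_w`
    have h2' : (2 : Polynomial k) = 0 := by rw [← map_ofNat Polynomial.C 2, h2, map_zero]
    have e : L * Z ^ q = 2 * L * U * W + L * Z ^ q - 2 * V * B := by
      linear_combination (-(L * U * W) + V * B) * h2'
    rw [e]; exact hE1w q hq23
  · -- `q ≤ 4`: the two other terms of the slice vanish at `T^q`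
    have hU : VanBelow 2 U := vanBelow_two_of_coeff hU0 hU1
    have hLUW : VanBelow (2 + c / 3) (2 * L * U * W) := by
      have := (hU.mul hW).mul_left (2 * L)
      rwa [show 2 * L * (U * W) = 2 * L * U * W by ring] at this
    have hVB : VanBelow (c / 2 + 1) (2 * V * B) := hEv.mul (vanBelow_one_of_coeff_zero hB0)
    have hq4' : (q : ℚ) ≤ 4 := by exact_mod_cast hq4
    have h1 : (2 * L * U * W).coeff q = 0 := hLUW q (by linarith)
    have h2 : (2 * V * B).coeff q = 0 := hVB q (by linarith)
    have h3 := hE1w q hq23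
    rw [Polynomial.coeff_sub, Polynomial.coeff_add, h1, h2, zero_add, sub_zero] at h3
    exact h3

end Endgame

/-! ## §5 The second vertex of the tail germ -/

section SecondVertex

variable {i j l e : Fin N} {q : ℕ}

/-- Coefficients of the normal form `C p₀ + C p₁ · ε + C p₂ · ε²` (plumbing). [folklore] -/
private theorem coeff_normalForm₉ (p₀ p₁ p₂ : Polynomial k) :
    (Polynomial.C p₀ + Polynomial.C p₁ * Polynomial.X + Polynomial.C p₂ * Polynomial.X ^ 2).coeff 0 = p₀ ∧
    (Polynomial.C p₀ + Polynomial.C p₁ * Polynomial.X + Polynomial.C p₂ * Polynomial.X ^ 2).coeff 1 = p₁ ∧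
    (Polynomial.C p₀ + Polynomial.C p₁ * Polynomial.X + Polynomial.C p₂ * Polynomial.X ^ 2).coeff 2 = p₂ := by
  simp only [Polynomial.coeff_add, Polynomial.coeff_C, Polynomial.coeff_C_mul_X, Polynomial.coeff_C_mul_X_pow]
  simp

/-- `(p ∂_i + q ∂_x)(P) = p ∂_i P + q ∂_x P` (plumbing). [folklore] -/
private theorem sum_pairField_mul₉ {i x : Fin N} (hix : i ≠ x) (p q : MvPolynomial (Fin N) k)
    (D : Fin N → MvPolynomial (Fin N) k) :
    ∑ m, pairField i x p q m * D m = p * D i + q * D x := by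
  classical
  have : ∀ m, pairField i x p q m * D m = (if m = i then p * D i else 0) + (if m = x then q * D x else 0) := by
    intro m
    unfold pairField
    by_cases h1 : m = i
    · subst h1; rw [if_pos rfl, if_pos rfl, if_neg hix, add_zero]
    · rw [if_neg h1, if_neg h1, zero_add]
      by_cases h2 : m = x
      · subst h2; rw [if_pos rfl, if_pos rfl]
      · rw [if_neg h2, if_neg h2, zero_mul]
  rw [Finset.sum_congr rfl fun m _ => this m, Finset.sum_add_distrib, Finset.sum_ite_eq' Finset.univ i,
    Finset.sum_ite_eq' Finset.univ x, if_pos (Finset.mem_univ _), if_pos (Finset.mem_univ _)]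

/-- The constant coefficient of a partial derivative is the linear coefficient (plumbing). [folklore] -/
private theorem constantCoeff_pderiv₉ (y : Fin N) (P : MvPolynomial (Fin N) k) :
    constantCoeff (pderiv y P) = coeff (Finsupp.single y 1) P := by
  classical
  induction P using MvPolynomial.induction_on with
  | C a =>
    rw [pderiv_C, map_zero, coeff_C, if_neg (Finsupp.single_ne_zero.2 one_ne_zero).symm]
  | add p q hp hq => rw [map_add, map_add, hp, hq, coeff_add]
  | mul_X p m hp =>
    rw [Derivation.leibniz, smul_eq_mul, smul_eq_mul, map_add, map_mul, map_mul, constantCoeff_X, zero_mul,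
      add_zero, pderiv_X, coeff_mul_X']
    by_cases hmy : m = y
    · subst hmy
      rw [Pi.single_eq_same, map_one, mul_one, if_pos (by simp), tsub_self, ← constantCoeff_eq]
    · have hns : m ∉ (Finsupp.single y 1).support := fun h =>
        hmy ((Finsupp.mem_support_single _ _ _).1 h).1
      rw [Pi.single_eq_of_ne hmy, map_zero, mul_zero, if_neg hns]

/-- An automorphism fixing the origin preserves constant coefficients (plumbing). [folklore] -/
private theorem constantCoeff_map_of_fix₉ (Φ : MvPolynomial (Fin N) k ≃ₐ[k] MvPolynomial (Fin N) k)
    (hΦ : ∀ m, constantCoeff (Φ (X m)) = 0) (P : MvPolynomial (Fin N) k) :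
    constantCoeff (Φ P) = constantCoeff P := by
  induction P using MvPolynomial.induction_on with
  | C a => rw [show Φ (C a) = C a from Φ.commutes a]
  | add p q hp hq => rw [map_add, map_add, hp, hq, map_add]
  | mul_X p m hp => rw [map_mul, map_mul, hp, hΦ, map_mul, constantCoeff_X]

/-- **Axis lemma for the tail germ.**  Let `(Ψ, γ)` be a centre for `f = X_i² + X_l X_j² + X_j X_e^q`
(`3 ≤ q`, `3q/2 < c`; `2 = 0` in `k` or `q ≤ 4`) with weights `γ a = 1/2`, `γ b₁ = γ b₂ = 1/3` and all other
weights `≤ 1/c`.  Then along every other axis `X_{e₁}` the linear `X_{e₁}`-coefficients of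
`Ψ⁻¹ X_i, Ψ⁻¹ X_j, Ψ⁻¹ X_l, Ψ⁻¹ X_e` vanish.  (Taylor expansions along `∂_i` and
`ξ_x = (∂_i v') ∂_x − (∂_x v') ∂_i`, `x ∈ {l, j}`; transfer of admissibility to `k[T][ε]`; then
`axis_endgame_tail`.) (derived here) [cite: AbramovichTemkinWlodarczyk2024, Thm. 5.3.1 (2) (p. 1578),
Lemma 5.2.10 (p. 1577); Temkin2025, §1.2.2 (1) (p. 4); CossartJannsenSaito2020, Def. 1.26] -/
theorem coeff_single_symm_eq_zero_of_vertex_tail (hij : i ≠ j) (hil : i ≠ l) (hie : i ≠ e) (hjl : j ≠ l)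
    (hje : j ≠ e) (hle : l ≠ e) (hq : 3 ≤ q) (h2q : (2 : k) = 0 ∨ q ≤ 4)
    {Ψ : MvPolynomial (Fin N) k ≃ₐ[k] MvPolynomial (Fin N) k} {γ : Fin N → ℚ}
    (hc : IsCentreFor (umbrellaTail k i j l e q) Ψ γ) {a b₁ b₂ : Fin N} (hγa : γ a = 1 / 2)
    (hγb₁ : γ b₁ = 1 / 3) (hγb₂ : γ b₂ = 1 / 3) {c : ℚ} (hqc : 3 * (q : ℚ) / 2 < c)
    (hE : ∀ m, m ≠ a → m ≠ b₁ → m ≠ b₂ → γ m ≤ 1 / c) {e₁ : Fin N} (he₁a : e₁ ≠ a)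
    (he₁b₁ : e₁ ≠ b₁) (he₁b₂ : e₁ ≠ b₂) {x : Fin N} (hx : x = i ∨ x = j ∨ x = l ∨ x = e) :
    coeff (Finsupp.single e₁ 1) (Ψ.symm (X x)) = 0 := by
  classical
  set f := umbrellaTail k i j l e q with hf
  have hq3 : (3 : ℚ) ≤ q := by exact_mod_cast hq
  have hc3 : (3 : ℚ) < c := by linarith
  have hc0 : (0 : ℚ) < c := by linarith
  -- derived weight facts
  have h1c : 1 / c ≤ (1 : ℚ) / 2 := one_div_le_one_div_of_le (by norm_num) (by linarith)
  have hle2 : ∀ m, γ m ≤ 1 / 2 := by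
    intro m
    by_cases hma : m = a
    · rw [hma, hγa]
    by_cases hm1 : m = b₁
    · rw [hm1, hγb₁]; norm_num
    by_cases hm2 : m = b₂
    · rw [hm2, hγb₂]; norm_num
    exact (hE m hma hm1 hm2).trans h1c
  have huniq : ∀ m, γ m = 1 / 2 → m = a := by
    intro m hm
    by_contra hma
    by_cases hm1 : m = b₁
    · rw [hm1, hγb₁] at hm; norm_num at hm
    by_cases hm2 : m = b₂
    · rw [hm2, hγb₂] at hm; norm_num at hm
    have h := hE m hma hm1 hm2
    rw [hm] at h
    have h' := mul_le_mul_of_nonneg_left h (by linarith : (0 : ℚ) ≤ 2 * c)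
    rw [show 2 * c * (1 / 2) = c by ring, show 2 * c * (1 / c) = 2 by field_simp] at h'
    linarith
  obtain ⟨hD, hLi⟩ := coeff_single_apex_of_initial (monomialOrd_umbrellaTail hij hil hie hjl (by omega))
    (homogeneousComponent_umbrellaTail (by omega)) (hironakaDelta_umbrellaTail hij hil hie hjl hle (by omega))
    hc hγa hle2 huniq
  -- the axis restriction `ρ = (X_{e₁} ↦ T, others ↦ 0) ∘ Ψ⁻¹`
  obtain ⟨ρ, hρ⟩ : ∃ ρ : MvPolynomial (Fin N) k →ₐ[k] Polynomial k, ∀ p, ρ p = axisHom e₁ (Ψ.symm p) :=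
    ⟨(axisHom e₁).comp (Ψ.symm : MvPolynomial (Fin N) k →ₐ[k] MvPolynomial (Fin N) k), fun _ => rfl⟩
  have hρΨ : ∀ m, ρ (Ψ (X m)) = if m = e₁ then Polynomial.X else 0 := fun m => by
    rw [hρ, AlgEquiv.symm_apply_apply, axisHom_X]
  have hρ0 : ∀ P, (ρ P).coeff 0 = constantCoeff P := fun P => by
    rw [hρ, coeff_zero_axisHom, constantCoeff_map_of_fix₉ Ψ.symm (constantCoeff_symm_X_eq_zero_of_forall Ψ hc.1)]
  have hρ1 : ∀ P, (ρ P).coeff 1 = coeff (Finsupp.single e₁ 1) (Ψ.symm P) := fun P => by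
    rw [hρ, coeff_one_axisHom]
  set v' := Ψ (X a) with hv'
  set V := ρ (X i) with hV
  set W := ρ (X j) with hW
  set U := ρ (X l) with hU
  set Z := ρ (X e) with hZ
  set L := ρ (pderiv i v') with hL'
  set B := ρ (pderiv j v') with hB
  set A := ρ (pderiv l v') with hA
  have hV0 : V.coeff 0 = 0 := by rw [hV, hρ0, constantCoeff_X]
  have hU0 : U.coeff 0 = 0 := by rw [hU, hρ0, constantCoeff_X]
  have hZ0 : Z.coeff 0 = 0 := by rw [hZ, hρ0, constantCoeff_X]
  have hL : L.coeff 0 ≠ 0 := by rw [hL', hρ0, constantCoeff_pderiv₉]; exact hLi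
  have hρv' : ρ v' = 0 := by rw [hv', hρΨ, if_neg (Ne.symm he₁a)]
  -- scaled weights `γ' = c·γ` and admissibility of `g = Ψ⁻¹ f`
  set g := Ψ.symm f with hg
  have hfg : f = Ψ g := by rw [hg, AlgEquiv.apply_symm_apply]
  have hadm : ∀ d ∈ g.support, c ≤ monomialValuation (fun m => c * γ m) d := by
    intro d hd
    have h1 : (1 : ℚ) ≤ monomialValuation γ d := hc.2.2 d hd
    have : monomialValuation (fun m => c * γ m) d = c * monomialValuation γ d := by
      rw [monomialValuation, monomialValuation, Finsupp.mul_sum]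
      exact Finsupp.sum_congr fun m _ => by ring
    rw [this]; nlinarith
  -- weights of the Taylor images of the centre variables
  have hweights : ∀ (ξ : Fin N → MvPolynomial (Fin N) k) (α : ℚ), 1 ≤ α → c / 3 ≤ α →
      VanBelow₂ α 1 (c * γ a) (fieldTaylor ρ ξ v') →
      ∀ m, VanBelow₂ α 1 (c * γ m) (fieldTaylor ρ ξ (Ψ (X m))) := by
    intro ξ α h1α hα3 ha m
    have hα0 : (0 : ℚ) ≤ α := by linarith
    by_cases hma : m = a
    · rw [hma]; exact ha
    by_cases hmb : m = b₁ ∨ m = b₂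
    · have hm0 : ρ (Ψ (X m)) = 0 := by
        rw [hρΨ, if_neg]
        rintro rfl
        rcases hmb with h | h
        · exact he₁b₁ h
        · exact he₁b₂ h
      have h := VanBelow₂.of_X_pow_dvd (P := fieldTaylor ρ ξ (Ψ (X m))) hα0 zero_le_one (m := 1)
        (by simpa only [pow_one] using X_dvd_fieldTaylor hm0)
      rw [Nat.cast_one, one_mul] at h
      refine h.mono ?_
      rcases hmb with h | h
      · rw [h, hγb₁]; linarith
      · rw [h, hγb₂]; linarith
    · push Not at hmb
      have hγm : c * γ m ≤ 1 := by
        have := mul_le_mul_of_nonneg_left (hE m hma hmb.1 hmb.2) hc0.le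
        rwa [mul_one_div_cancel hc0.ne'] at this
      refine VanBelow₂.of_coeff_coeff_zero hα0 zero_le_one (hγm.trans h1α) hγm ?_
      rw [coeff_zero_fieldTaylor, hρΨ]
      split_ifs
      · exact Polynomial.coeff_X_zero
      · exact Polynomial.coeff_zero 0
  -- transfer of admissibility: `Taylor(f)` has weighted order `≥ c`
  have htransfer : ∀ (ξ : Fin N → MvPolynomial (Fin N) k) (α : ℚ), 1 ≤ α → c / 3 ≤ α →
      VanBelow₂ α 1 (c * γ a) (fieldTaylor ρ ξ v') → VanBelow₂ α 1 c (fieldTaylor ρ ξ f) := by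
    intro ξ α h1α hα3 ha
    have hα0 : (0 : ℚ) ≤ α := by linarith
    have h := VanBelow₂.map_of_le_monomialValuation hα0 zero_le_one
      ((fieldTaylor ρ ξ).comp (Ψ : MvPolynomial (Fin N) k →ₐ[k] MvPolynomial (Fin N) k))
      (γ := fun m => c * γ m) (fun m => hweights ξ α h1α hα3 ha m) hadm
    have h' : VanBelow₂ α 1 c (fieldTaylor ρ ξ (Ψ g)) := h
    rwa [← hfg] at h'
  -- (a) the direction `∂_i`
  set ξv : Fin N → MvPolynomial (Fin N) k := fun m => if m = i then 1 else 0 with hξv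
  have hTv : VanBelow₂ (c / 2) 1 c (fieldTaylor ρ ξv f) := by
    refine htransfer ξv (c / 2) (by linarith) (by linarith) ?_
    have h := VanBelow₂.of_X_pow_dvd (P := fieldTaylor ρ ξv v') (by linarith : (0 : ℚ) ≤ c / 2) zero_le_one
      (m := 1) (by simpa only [pow_one] using X_dvd_fieldTaylor hρv')
    rw [Nat.cast_one, one_mul] at h
    refine h.mono ?_
    rw [hγa]; linarith
  have hexp_v : fieldTaylor ρ ξv f = Polynomial.C (V ^ 2 + U * W ^ 2 + W * Z ^ q) +
      Polynomial.C (2 * V) * Polynomial.X + Polynomial.C 1 * Polynomial.X ^ 2 := by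
    have e1 : ξv i = 1 := by simp [hξv]
    have e2 : ξv j = 0 := by simp [hξv, hij.symm]
    have e3 : ξv l = 0 := by simp [hξv, hil.symm]
    have e4 : ξv e = 0 := by simp [hξv, hie.symm]
    rw [hf, umbrellaTail_eq]
    simp only [map_add, map_mul, map_pow, fieldTaylor_X, e1, e2, e3, e4, map_one, map_zero, mul_zero, add_zero]
    simp only [map_ofNat]
    ring
  have hEv : VanBelow (c / 2) (2 * V) := fun n hn => by
    have h := hTv 1 n (by rw [Nat.cast_one, one_mul, mul_one]; linarith)
    rwa [hexp_v, (coeff_normalForm₉ _ _ _).2.1] at h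
  -- (b) the direction `ξ_u = (∂_i v') ∂_l − (∂_l v') ∂_i`
  set ξu := pairField i l (-pderiv l v') (pderiv i v') with hξu
  have hTu : VanBelow₂ (c / 3) 1 c (fieldTaylor ρ ξu f) := by
    refine htransfer ξu (c / 3) (by linarith) le_rfl ?_
    have hsum : ∑ m, ξu m * pderiv m v' = 0 := by rw [hξu, sum_pairField_mul₉ hil]; ring
    have h := VanBelow₂.of_X_pow_dvd (P := fieldTaylor ρ ξu v') (by linarith : (0 : ℚ) ≤ c / 3) zero_le_one
      (m := 2) (X_sq_dvd_fieldTaylor hρv' (by rw [hsum, map_zero]))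
    refine h.mono ?_
    rw [hγa]; push_cast; linarith
  have hexp_u : fieldTaylor ρ ξu f = Polynomial.C (V ^ 2 + U * W ^ 2 + W * Z ^ q) +
      Polynomial.C (L * W ^ 2 - 2 * V * A) * Polynomial.X + Polynomial.C (A ^ 2) * Polynomial.X ^ 2 := by
    have e1 : ξu i = -pderiv l v' := by simp [hξu, pairField]
    have e2 : ξu l = pderiv i v' := by simp [hξu, pairField, hil.symm]
    have e3 : ξu j = 0 := by simp [hξu, pairField, hij.symm, hjl]
    have e4 : ξu e = 0 := by simp [hξu, pairField, hie.symm, hle.symm]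
    rw [hf, umbrellaTail_eq]
    simp only [map_add, map_mul, map_pow, fieldTaylor_X, e1, e2, e3, e4, map_neg, map_zero, mul_zero, add_zero]
    simp only [map_sub, map_mul, map_pow, map_ofNat]
    ring
  have hZvan : VanBelow c (V ^ 2 + U * W ^ 2 + W * Z ^ q) := fun n hn => by
    have h := hTu 0 n (by rw [Nat.cast_zero, zero_mul, zero_add, mul_one]; exact hn)
    rwa [hexp_u, (coeff_normalForm₉ _ _ _).1] at h
  have hE1u : VanBelow (2 * c / 3) (L * W ^ 2 - 2 * V * A) := fun n hn => by
    have h := hTu 1 n (by rw [Nat.cast_one, one_mul, mul_one]; linarith)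
    rwa [hexp_u, (coeff_normalForm₉ _ _ _).2.1] at h
  have hE2u : VanBelow (c / 3) (A ^ 2) := fun n hn => by
    have h := hTu 2 n (by rw [Nat.cast_two, mul_one]; linarith)
    rwa [hexp_u, (coeff_normalForm₉ _ _ _).2.2] at h
  -- (c) the direction `ξ_w = (∂_i v') ∂_j − (∂_j v') ∂_i`
  set ξw := pairField i j (-pderiv j v') (pderiv i v') with hξw
  have hTw : VanBelow₂ (c / 3) 1 c (fieldTaylor ρ ξw f) := by
    refine htransfer ξw (c / 3) (by linarith) le_rfl ?_
    have hsum : ∑ m, ξw m * pderiv m v' = 0 := by rw [hξw, sum_pairField_mul₉ hij]; ring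
    have h := VanBelow₂.of_X_pow_dvd (P := fieldTaylor ρ ξw v') (by linarith : (0 : ℚ) ≤ c / 3) zero_le_one
      (m := 2) (X_sq_dvd_fieldTaylor hρv' (by rw [hsum, map_zero]))
    refine h.mono ?_
    rw [hγa]; push_cast; linarith
  have hexp_w : fieldTaylor ρ ξw f = Polynomial.C (V ^ 2 + U * W ^ 2 + W * Z ^ q) +
      Polynomial.C (2 * L * U * W + L * Z ^ q - 2 * V * B) * Polynomial.X +
      Polynomial.C (B ^ 2 + L ^ 2 * U) * Polynomial.X ^ 2 := by
    have e1 : ξw i = -pderiv j v' := by simp [hξw, pairField]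
    have e2 : ξw j = pderiv i v' := by simp [hξw, pairField, hij.symm]
    have e3 : ξw l = 0 := by simp [hξw, pairField, hil.symm, Ne.symm hjl]
    have e4 : ξw e = 0 := by simp [hξw, pairField, hie.symm, Ne.symm hje]
    rw [hf, umbrellaTail_eq]
    simp only [map_add, map_mul, map_pow, fieldTaylor_X, e1, e2, e3, e4, map_neg, map_zero, mul_zero, add_zero]
    simp only [map_add, map_sub, map_mul, map_pow, map_ofNat]
    ring
  have hE1w : VanBelow (2 * c / 3) (2 * L * U * W + L * Z ^ q - 2 * V * B) := fun n hn => by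
    have h := hTw 1 n (by rw [Nat.cast_one, one_mul, mul_one]; linarith)
    rwa [hexp_w, (coeff_normalForm₉ _ _ _).2.1] at h
  have hE2w : VanBelow (c / 3) (B ^ 2 + L ^ 2 * U) := fun n hn => by
    have h := hTw 2 n (by rw [Nat.cast_two, mul_one]; linarith)
    rwa [hexp_w, (coeff_normalForm₉ _ _ _).2.2] at h
  -- the endgame
  obtain ⟨hV1, hW1, hU1, hZ1⟩ := axis_endgame_tail hq hqc h2q hL hV0 hU0 hZ0 hZvan hEv hE1u hE1w hE2u hE2w
  rw [← hρ1]
  rcases hx with rfl | rfl | rfl | rfl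
  exacts [hV1, hW1, hU1, hZ1]

/-- **Second vertex of the tail germ, weight form.**  For `f = X_i² + X_l X_j² + X_j X_e^q` (`i, j, l, e`
distinct, spectators allowed, `3 ≤ q`, `3q/2 < c`; `2 = 0` in `k` or `q ≤ 4`) there is NO centre `(Ψ, γ)` —
`Ψ` ANY polynomial automorphism fixing the origin — with weights `γ a = 1/2`, `γ b₁ = γ b₂ = 1/3` and all
other weights `≤ 1/c`.  (The rows `i, j, l, e` of the Jacobian of `Ψ⁻¹` at `0` would be supported on the
three columns `a, b₁, b₂`.) (derived here) [cite: AbramovichTemkinWlodarczyk2024, Thm. 5.3.1 (2) (p. 1578),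
§3.4 (p. 1570); Temkin2025, §1.2.2 (1) (p. 4)] -/
theorem not_isCentreFor_umbrellaTail_vertex (hij : i ≠ j) (hil : i ≠ l) (hie : i ≠ e) (hjl : j ≠ l)
    (hje : j ≠ e) (hle : l ≠ e) (hq : 3 ≤ q) (h2q : (2 : k) = 0 ∨ q ≤ 4)
    {Ψ : MvPolynomial (Fin N) k ≃ₐ[k] MvPolynomial (Fin N) k} {γ : Fin N → ℚ} {a b₁ b₂ : Fin N}
    (hγa : γ a = 1 / 2) (hγb₁ : γ b₁ = 1 / 3) (hγb₂ : γ b₂ = 1 / 3) {c : ℚ} (hqc : 3 * (q : ℚ) / 2 < c)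
    (hE : ∀ m, m ≠ a → m ≠ b₁ → m ≠ b₂ → γ m ≤ 1 / c) :
    ¬ IsCentreFor (umbrellaTail k i j l e q) Ψ γ := by
  classical
  intro hc
  have hFcard : ({i, j, l, e} : Finset (Fin N)).card = 4 := by
    rw [Finset.card_insert_of_notMem (by simp [hij, hil, hie]), Finset.card_insert_of_notMem (by simp [hjl, hje]),
      Finset.card_pair hle]
  have hlt : ({a, b₁, b₂} : Finset (Fin N)).card < ({i, j, l, e} : Finset (Fin N)).card := by
    rw [hFcard]
    exact Nat.lt_of_le_of_lt Finset.card_le_three (by norm_num)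
  exact false_of_jacobian_rows_supported hc.1 {i, j, l, e} {a, b₁, b₂} hlt fun s hs x hx => by
    simp only [Finset.mem_insert, Finset.mem_singleton, not_or] at hs
    have hx' : x = i ∨ x = j ∨ x = l ∨ x = e := by
      simpa only [Finset.mem_insert, Finset.mem_singleton] using hx
    exact coeff_single_symm_eq_zero_of_vertex_tail hij hil hie hjl hje hle hq h2q hc hγa hγb₁ hγb₂ hqc hE hs.1
      hs.2.1 hs.2.2 hx'

end SecondVertex

/-! ## §6 Invariant form and the maximum -/

section Assembly

variable {i j l e : Fin N} {q : ℕ}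

/-- Non-negativity survives forgetting a variable (plumbing). [folklore] -/
private theorem update_nonneg₉ {γ : Fin N → ℚ} (hγ : ∀ x, 0 ≤ γ x) (a : Fin N) (x : Fin N) :
    0 ≤ Function.update γ a 0 x := by
  by_cases hx : x = a
  · subst hx; simp
  · rw [Function.update_of_ne hx]; exact hγ x

/-- **Second vertex of the tail germ, invariant form**: no centre for `X_i² + X_l X_j² + X_j X_e^q` has
invariant `(2, 3, 3, t…)` with every entry of `t` at least `c > 3q/2` — in particular `t = ()` or
`t = (c, …)` (`3 ≤ q`; `2 = 0` in `k` or `q ≤ 4`; ALL polynomial coordinate changes). (derived here, by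
peeling the weights `1/2, 1/3, 1/3` off `exps γ`) [cite: AbramovichTemkinWlodarczyk2024, Thm. 5.3.1 (2)
(p. 1578), §5.1 (p. 1575); Temkin2025, §1.2.2 (1) (p. 4)] -/
theorem not_isCentreFor_umbrellaTail_of_exps (hij : i ≠ j) (hil : i ≠ l) (hie : i ≠ e) (hjl : j ≠ l)
    (hje : j ≠ e) (hle : l ≠ e) (hq : 3 ≤ q) (h2q : (2 : k) = 0 ∨ q ≤ 4)
    {Ψ : MvPolynomial (Fin N) k ≃ₐ[k] MvPolynomial (Fin N) k} {γ : Fin N → ℚ} {t : List ℚ}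
    (hexps : exps γ = (2 : ℚ) :: 3 :: 3 :: t) {c : ℚ} (hqc : 3 * (q : ℚ) / 2 < c) (ht : ∀ y ∈ t, c ≤ y) :
    ¬ IsCentreFor (umbrellaTail k i j l e q) Ψ γ := by
  classical
  intro hc
  have hc0 : (0 : ℚ) < c := lt_of_le_of_lt (by positivity) hqc
  obtain ⟨a, -, hγa, hta⟩ := exists_update_of_exps_eq_cons hexps
  obtain ⟨b₁, hγb₁0, hγb₁, htb⟩ := exists_update_of_exps_eq_cons hta
  have hb₁a : b₁ ≠ a := by rintro rfl; rw [Function.update_self] at hγb₁0; exact hγb₁0 rfl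
  rw [Function.update_of_ne hb₁a] at hγb₁
  obtain ⟨b₂, hγb₂0, hγb₂, ht₂⟩ := exists_update_of_exps_eq_cons htb
  have hb₂b₁ : b₂ ≠ b₁ := by rintro rfl; rw [Function.update_self] at hγb₂0; exact hγb₂0 rfl
  rw [Function.update_of_ne hb₂b₁] at hγb₂ hγb₂0
  have hb₂a : b₂ ≠ a := by rintro rfl; rw [Function.update_self] at hγb₂0; exact hγb₂0 rfl
  rw [Function.update_of_ne hb₂a] at hγb₂
  have hnn : ∀ x, 0 ≤ Function.update (Function.update (Function.update γ a 0) b₁ 0) b₂ 0 x :=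
    update_nonneg₉ (update_nonneg₉ (update_nonneg₉ hc.2.1 a) b₁) b₂
  have hE : ∀ m, m ≠ a → m ≠ b₁ → m ≠ b₂ → γ m ≤ 1 / c := fun m hma hmb₁ hmb₂ => by
    have h := le_inv_of_exps_eq ht₂ hc0 ht hnn m
    rwa [Function.update_of_ne hmb₂, Function.update_of_ne hmb₁, Function.update_of_ne hma] at h
  exact not_isCentreFor_umbrellaTail_vertex hij hil hie hjl hje hle hq h2q (by rw [hγa, one_div])
    (by rw [hγb₁, one_div]) (by rw [hγb₂, one_div]) hqc hE hc

/-- **`(2, 3, 3) ∉ W(X_i² + X_l X_j² + X_j X_e^q)`** (`3 ≤ q`; `2 = 0` in `k` or `q ≤ 4`). (derived here)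
[cite: AbramovichTemkinWlodarczyk2024, Thm. 5.3.1 (2) (p. 1578); Temkin2025, §1.2.2 (1) (p. 4)] -/
theorem triple_not_mem_admissibleInvariants_umbrellaTail (hij : i ≠ j) (hil : i ≠ l) (hie : i ≠ e)
    (hjl : j ≠ l) (hje : j ≠ e) (hle : l ≠ e) (hq : 3 ≤ q) (h2q : (2 : k) = 0 ∨ q ≤ 4) :
    [(2 : ℚ), 3, 3] ∉ admissibleInvariants (umbrellaTail k i j l e q) := by
  rintro ⟨Ψ, γ, hc, hexps⟩
  exact not_isCentreFor_umbrellaTail_of_exps hij hil hie hjl hje hle hq h2q hexps (c := 3 * (q : ℚ) / 2 + 1)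
    (lt_add_one _) (fun y hy => by simp at hy) hc

/-- **`(2, 3, 3, c, …) ∉ W(X_i² + X_l X_j² + X_j X_e^q)` for every `c > 3q/2`** (`3 ≤ q`; `2 = 0` in `k` or
`q ≤ 4`; `i, j, l, e` distinct, any number of spectators, ALL polynomial coordinate changes). (derived here)
[cite: AbramovichTemkinWlodarczyk2024, Thm. 5.3.1 (2) (p. 1578); Temkin2025, §1.2.2 (1) (p. 4)] -/
theorem cons₄_not_mem_admissibleInvariants_umbrellaTail (hij : i ≠ j) (hil : i ≠ l) (hie : i ≠ e)
    (hjl : j ≠ l) (hje : j ≠ e) (hle : l ≠ e) (hq : 3 ≤ q) (h2q : (2 : k) = 0 ∨ q ≤ 4) {c : ℚ}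
    (hqc : 3 * (q : ℚ) / 2 < c) (rest : List ℚ) :
    ((2 : ℚ) :: 3 :: 3 :: c :: rest) ∉ admissibleInvariants (umbrellaTail k i j l e q) := by
  rintro ⟨Ψ, γ, hc, hexps⟩
  have hsorted : ((2 : ℚ) :: 3 :: 3 :: c :: rest).Pairwise (· ≤ ·) := hexps ▸ exps_sorted γ
  have h4 : (c :: rest).Pairwise (· ≤ ·) :=
    (List.pairwise_cons.1 (List.pairwise_cons.1 (List.pairwise_cons.1 hsorted).2).2).2
  have hrest : ∀ y ∈ c :: rest, c ≤ y := fun y hy => by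
    rcases List.mem_cons.1 hy with rfl | hy
    · exact le_rfl
    · exact (List.pairwise_cons.1 h4).1 y hy
  exact not_isCentreFor_umbrellaTail_of_exps hij hil hie hjl hje hle hq h2q hexps hqc hrest hc

/-- **`max W(X_i² + X_l X_j² + X_j X_e^q) = (2, 3, 3, 3q/2)`** in the cell's polynomial weighted-centre model
(`i, j, l, e` distinct, any number of spectator variables, ALL polynomial coordinate changes fixing the
origin; `3 ≤ q`, and `2 = 0` in `k` or `q ≤ 4`): the invariant of the coordinate centre
`(X_i², X_j³, X_l³, X_e^{3q/2})` is attained and nothing in `W` exceeds it in the truncated-lexicographic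
order.  (derived here) Instrument of the Resolution Observatory — NOT a resolution theorem.
[cite: AbramovichTemkinWlodarczyk2024, Thm. 5.3.1 (2) (p. 1578) (inv_p = max over admissible centres);
CossartJannsenSaito2020, Thm. 8.16 (p. 121); Temkin2025, §1.2.2 (1) (p. 4)] -/
theorem isMaxInv_umbrellaTail (hij : i ≠ j) (hil : i ≠ l) (hie : i ≠ e) (hjl : j ≠ l) (hje : j ≠ e)
    (hle : l ≠ e) (hq : 3 ≤ q) (h2q : (2 : k) = 0 ∨ q ≤ 4) :
    IsMaxInv (admissibleInvariants (umbrellaTail k i j l e q)) [(2 : ℚ), 3, 3, 3 * (q : ℚ) / 2] := by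
  refine ⟨umbrellaTail_inv_mem hij hil hie hjl hje hle (by omega), fun b hb hlt => ?_⟩
  have hup : ¬ ATW.TruncLex.lt [(2 : ℚ), 3, 3] b :=
    not_lt_of_mem_admissibleInvariants_umbrellaTail hij hil hie hjl hle hq hb
  rcases b with _ | ⟨x₁, t₁⟩
  · exact nil_not_mem_admissibleInvariants (umbrellaTail_ne_zero hij hil hie hjl) hb
  rw [ATW.TruncLex.cons_lt_cons] at hup hlt
  push Not at hup
  rcases hlt with h | ⟨rfl, hlt₁⟩
  · exact absurd h (not_lt.2 hup.1)
  have hup₁ := hup.2 rfl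
  rcases t₁ with _ | ⟨x₂, t₂⟩
  · exact absurd (ATW.TruncLex.cons_lt_nil _ _) hup₁
  rw [ATW.TruncLex.cons_lt_cons] at hup₁ hlt₁
  push Not at hup₁
  rcases hlt₁ with h | ⟨rfl, hlt₂⟩
  · exact absurd h (not_lt.2 hup₁.1)
  have hup₂ := hup₁.2 rfl
  rcases t₂ with _ | ⟨x₃, t₃⟩
  · exact absurd (ATW.TruncLex.cons_lt_nil _ _) hup₂
  rw [ATW.TruncLex.cons_lt_cons] at hup₂ hlt₂
  push Not at hup₂
  rcases hlt₂ with h | ⟨rfl, hlt₃⟩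
  · exact absurd h (not_lt.2 hup₂.1)
  rcases t₃ with _ | ⟨c, rest⟩
  · exact triple_not_mem_admissibleInvariants_umbrellaTail hij hil hie hjl hje hle hq h2q hb
  rw [ATW.TruncLex.cons_lt_cons] at hlt₃
  rcases hlt₃ with hqc | ⟨-, hnil⟩
  · exact cons₄_not_mem_admissibleInvariants_umbrellaTail hij hil hie hjl hje hle hq h2q hqc rest hb
  · exact absurd hnil (ATW.TruncLex.not_nil_lt _)

/-- **Census row `v² + u w² + w z⁴`: `max W = (2, 3, 3, 6)` in EVERY characteristic**, for all polynomial
coordinate changes and any number of spectators (the row was recorded over `𝔽₂`). (derived here)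
Instrument — NOT a resolution theorem. [cite: AbramovichTemkinWlodarczyk2024, Thm. 5.3.1 (2) (p. 1578);
Temkin2025, §1.2.2 (1) (p. 4)] -/
theorem isMaxInv_umbrellaTail_four (hij : i ≠ j) (hil : i ≠ l) (hie : i ≠ e) (hjl : j ≠ l) (hje : j ≠ e)
    (hle : l ≠ e) :
    IsMaxInv (admissibleInvariants (umbrellaTail k i j l e 4)) [(2 : ℚ), 3, 3, 6] := by
  have h := isMaxInv_umbrellaTail (k := k) hij hil hie hjl hje hle (by norm_num : 3 ≤ 4) (Or.inr le_rfl)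
  norm_num at h
  exact h

/-- **`v² + u w² + w z³`: `max W = (2, 3, 3, 9/2)` in EVERY characteristic** (a non-integral maximal
invariant). (derived here) Instrument — NOT a resolution theorem. [cite: AbramovichTemkinWlodarczyk2024,
Thm. 5.3.1 (2) (p. 1578); Temkin2025, §1.2.2 (1) (p. 4)] -/
theorem isMaxInv_umbrellaTail_three (hij : i ≠ j) (hil : i ≠ l) (hie : i ≠ e) (hjl : j ≠ l) (hje : j ≠ e)
    (hle : l ≠ e) :
    IsMaxInv (admissibleInvariants (umbrellaTail k i j l e 3)) [(2 : ℚ), 3, 3, 9 / 2] := by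
  have h := isMaxInv_umbrellaTail (k := k) hij hil hie hjl hje hle (le_refl 3) (Or.inr (by norm_num))
  norm_num at h
  exact h

/-- **Characteristic `2`, every `q ≥ 3`: `max W(v² + u w² + w z^q) = (2, 3, 3, 3q/2)`.** (derived here)
Instrument — NOT a resolution theorem. [cite: Temkin2025, §1.2.2 (1) (p. 4);
AbramovichTemkinWlodarczyk2024, Thm. 5.3.1 (2) (p. 1578)] -/
theorem isMaxInv_umbrellaTail_charTwo [CharP k 2] (hij : i ≠ j) (hil : i ≠ l) (hie : i ≠ e) (hjl : j ≠ l)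
    (hje : j ≠ e) (hle : l ≠ e) (hq : 3 ≤ q) :
    IsMaxInv (admissibleInvariants (umbrellaTail k i j l e q)) [(2 : ℚ), 3, 3, 3 * (q : ℚ) / 2] :=
  isMaxInv_umbrellaTail hij hil hie hjl hje hle hq (Or.inl (CharTwo.two_eq_zero (R := k)))

end Assembly

end Literature.AlgebraicGeometry.Resolution.WeightedBlowup
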